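import Summits.QuantumFields.YangMills.Theorems.ColdStartUniversalityLatticeLangevinHypercontractiveDecorrelation
import Summits.QuantumFields.YangMills.Theorems.ColdStartUniversalityLatticeLangevinBakryEmeryConcentration
import HarnessLib

/-!
# Route `ColdStartUniversality` (fixed-cut-off package, `Lᵖ` side): ★★★ VOLUME-FREE GAUSSIAN CONCENTRATION OF A SINGLE SAMPLE of the
# cold-start SZZ dynamics after the `O(log L)` hypercontractive burn-in, `|β'| < 1/12`

Helper file (seat `ym-line-csu-p1`, g36; `--supports stmt-QuantumFields-24809`).  The `L²`-WARM START after the burn-in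
(`abs_integral_transition_le_exp_mul_of_warm`, g36: `∫ φ d law(U_{2+t₀+u}) ≤ e‖φ‖_{L²(μ)}`, `log B ≤ 2(1−12|β'|)t₀`, `B = O(L³)` explicit)
transfers every statement about `μ_{β'}` to the law of ONE configuration of the simulation at the price of a square root and a factor `e`:

* ★★ `measureReal_map_le_exp_mul_sqrt_uniform` — EVENTS: `P(U_{2+t₀+u} ∈ A) ≤ e·μ_{β'}(A)^{1/2}` for every measurable `A`, every `u ≥ 0`,
  every solution from a deterministic start;
* ★★★ `coldStart_concentration_uniform` — GAUSSIAN CONCENTRATION OF A SINGLE SAMPLE: for `f ∈ C³` with carré du champ `Γ(f) ≤ s` on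
  `SU(2)^E` and every `r ≥ 0`:  `P[ f(coords U_{2+t₀+u}) ≥ ∫F dμ_{β'} + r ] ≤ e·exp(−(1 − 12|β'|)·r²/(2s))` — from g26's volume-uniform
  concentration under `μ_{β'}` (`wilson_concentration_uniform`).  For a spatially AVERAGED observable (`s = O(1/L³)`, e.g. the mean plaquette,
  `…PlaquetteCarre`) one configuration of the simulation after `O(log L)` sweeps estimates the Gibbs mean to precision `O(L^{-3/2})` with
  Gaussian tails, uniformly in the volume.

THEOREMS ONLY, no definition, no sorry.  HONEST FRAMING: RECORD-rung R3 plumbing at FIXED cut-off in LATTICE units, high-temperature window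
`|β'| < 1/12` only; nothing K-uniform; no crux, rung or summit statement is proved; the Yang–Mills mass gap is NOT proved.
-/

set_option autoImplicit false

noncomputable section

namespace Summit.QuantumFields.YangMills.Theorems.ColdStartUniversality

open MeasureTheory ProbabilityTheory Filter Set Topology
open scoped BigOperators NNReal ENNReal
open Literature.Probability.Process Literature.MathematicalPhysics.QuantumFieldTheory
open Literature.MathematicalPhysics.QuantumLattice (fundamentalRep fundamentalLatticeRep continuous_fundamentalRep)

variable {L : ℕ} [NeZero L]

/-- ★★ **Events under the law of one sample after the burn-in.**  For every `L`, `|β'| < 1/12`, every deterministic start `z`, EVERY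
strong solution `U` from `z` on ANY filtered probability space, every measurable set `A`, all `t₀, u ≥ 0` with `log B ≤ 2(1 − 12|β'|)t₀`:
`P(U_{2+t₀+u} ∈ A) ≤ e · μ_{β'}(A)^{1/2}` (the `L²`-warm start at `φ = 1_A`). [cite: DiaconisSaloffcoste1996, Theorem 3.7] -/
theorem measureReal_map_le_exp_mul_sqrt_uniform (L : ℕ) [NeZero L] (β' : ℝ) (hβ : |β'| < 1 / 12)
    (z : GaugeConfig 3 L (Matrix.specialUnitaryGroup (Fin 2) ℂ))
    {Ω : Type} [MeasurableSpace Ω] {P : Measure Ω} [IsProbabilityMeasure P]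
    {W : ℝ≥0 → Ω → (Edge 3 L × NoiseIdx 2 → ℝ)} (hW : IsFlatBrownian W P)
    {U : ℝ≥0 → Ω → GaugeConfig 3 L (Matrix.specialUnitaryGroup (Fin 2) ℂ)} (hU0 : ∀ ω, U 0 ω = z)
    (hU : (latticeLangevinDynamics (fundamentalLatticeRep 2) β').IsSolution (fundamentalRep (Fin 2)) hW.natFiltration P W U)
    {A : Set (GaugeConfig 3 L (Matrix.specialUnitaryGroup (Fin 2) ℂ))} (hA : MeasurableSet A) (t₀ u : ℝ≥0)
    (ht₀ : Real.log (96 * |β'| * (Fintype.card (Edge 3 L) : ℝ) + 10 * |β'| * (Fintype.card (Plaquette 3 L) : ℝ) + Real.log 2 +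
      (Fintype.card (Edge 3 L) : ℝ) * Real.log (3 / 2)) ≤ 2 * (1 - 12 * |β'|) * t₀) :
    (P.map (U (2 + t₀ + u))).real A ≤
      Real.exp 1 * ((wilsonMeasure (d := 3) (L := L) (fundamentalRep (Fin 2)) β').real A) ^ (1 / (2 : ℝ)) := by
  classical
  haveI := secondCountableTopology_su2
  haveI := borelSpace_config L
  haveI : IsProbabilityMeasure (wilsonMeasure (d := 3) (L := L) (fundamentalRep (Fin 2)) β') :=
    isProbabilityMeasure_wilsonMeasure (d := 3) (L := L) (fundamentalRep (Fin 2)) (continuous_fundamentalRep (Fin 2)) β'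
  obtain ⟨κ, hκM, -, hreal⟩ := exists_transitionKernel L β'
  haveI := hκM
  -- the density bound at time `2`
  obtain ⟨hDe, hlogD⟩ := coldStart_density_constant_facts L β'
  obtain ⟨D, hDdef⟩ : ∃ D : ℝ, (Real.exp ((48 * |β'| * (Fintype.card (Edge 3 L) : ℝ)) * ((2 : ℝ≥0) : ℝ) +
      (2 * |β'| * (Fintype.card (Plaquette 3 L) : ℝ))) * (2 * (3 / 2 : ℝ) ^ Fintype.card (Edge 3 L))) *
      (Real.exp (|β'| * (4 * (Fintype.card (Plaquette 3 L) : ℝ))) * Real.exp (|β'| * (4 * (Fintype.card (Plaquette 3 L) : ℝ)))) = D :=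
    ⟨_, rfl⟩
  rw [hDdef] at hDe hlogD
  have hle₁ := map_le_smul_haar_explicit (L := L) β' (t := 2) (by norm_num) z hW hU0 hU
  obtain ⟨-, hπle⟩ := wilsonMeasure_le_smul_pi_haar_and_explicit (L := L) β'
  have hν : P.map (U 2) ≤ (ENNReal.ofReal D) • wilsonMeasure (d := 3) (L := L) (fundamentalRep (Fin 2)) β' := by
    rw [← hDdef, ENNReal.ofReal_mul (by positivity), Measure.le_iff]
    intro S hS
    have e1 := Measure.le_iff.1 hle₁ S hS
    have e2 := Measure.le_iff.1 hπle S hS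
    simp only [Measure.smul_apply, smul_eq_mul] at e1 e2 ⊢
    calc (P.map (U 2)) S ≤ _ := e1
      _ ≤ _ := mul_le_mul' le_rfl e2
      _ = _ := (mul_assoc _ _ _).symm
  haveI : IsProbabilityMeasure (P.map (U 2)) :=
    Measure.isProbabilityMeasure_map ((hU.adapted 2).mono (hW.natFiltration.le 2) le_rfl).aemeasurable
  have ht₀' : Real.log (Real.log D) ≤ 4 * ((1 - 12 * |β'|) / 2) * t₀ := by rw [hlogD]; linarith
  -- the indicator observable
  set φ : GaugeConfig 3 L (Matrix.specialUnitaryGroup (Fin 2) ℂ) → ℝ := A.indicator 1 with hφ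
  have hφm : Measurable φ := measurable_one.indicator hA
  have hφb : ∀ x, |φ x| ≤ 1 := by
    intro x
    by_cases hx : x ∈ A
    · simp [hφ, Set.indicator_of_mem hx]
    · simp [hφ, Set.indicator_of_notMem hx]
  have hmU : ∀ r : ℝ≥0, Measurable (U r) := fun r => (hU.adapted r).mono (hW.natFiltration.le r) le_rfl
  -- `P(U_{2+t₀+u} ∈ A) = ∫ κ_{t₀+u} 1_A d law(U₂)`
  have hE : (P.map (U (2 + t₀ + u))).real A = ∫ y, (∫ y', φ y' ∂(κ (t₀ + u) y)) ∂(P.map (U 2)) := by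
    rw [← integral_indicator_one hA, ← hreal (2 + t₀ + u) z Ω P W hW U hU0 hU, add_assoc,
      chapmanKolmogorov_szz β' κ hreal 2 (t₀ + u), ← hreal 2 z Ω P W hW U hU0 hU]
    haveI : IsProbabilityMeasure ((κ (t₀ + u) ∘ₖ κ 2) z) := by
      rw [← chapmanKolmogorov_szz β' κ hreal 2 (t₀ + u)]; infer_instance
    exact Kernel.integral_comp (integrable_of_abs_le _ hφm hφb)
  rw [hE]
  have hρ : 0 ≤ (1 - 12 * |β'|) / 2 := by linarith
  have hwarm := abs_integral_transition_le_exp_mul_of_warm L β' κ hreal hρ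
    (fun g hg => wilson_generatorLogSobolev_uniform L β' hβ g hg) hDe hν ht₀' hφm hφb u
  have e2 : ∫ x, |φ x| ^ (2 : ℝ) ∂(wilsonMeasure (d := 3) (L := L) (fundamentalRep (Fin 2)) β') =
      (wilsonMeasure (d := 3) (L := L) (fundamentalRep (Fin 2)) β').real A := by
    rw [← integral_indicator_one hA]
    refine integral_congr_ae (Eventually.of_forall fun x => ?_)
    by_cases hx : x ∈ A
    · simp [hφ, Set.indicator_of_mem hx]
    · simp [hφ, Set.indicator_of_notMem hx]
  rw [e2] at hwarm
  exact (le_abs_self _).trans hwarm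

/-- ★★★ **Volume-free Gaussian concentration of a single sample after the burn-in.**  For every `L`, `|β'| < 1/12`, every `C³` function
`f` of the real link coordinates with carré du champ `Γ(f) ≤ s` (`s > 0`) on `SU(2)^E`, every deterministic start `z`, EVERY strong solution
`U` from `z`, all `t₀, u ≥ 0` with `log B ≤ 2(1 − 12|β'|)t₀` and every `r ≥ 0`:

  `P[ ∫F dμ_{β'} + r ≤ f(coords U_{2+t₀+u}) ] ≤ e · exp(−(1 − 12|β'|)·r²/(2s))`,   `F = f∘coords`.

(`P(U_a ∈ A) ≤ e·μ(A)^{1/2}` and `μ_{β'}(A) ≤ exp(−(1−12|β'|)r²/s)`, `wilson_concentration_uniform`.)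
[cite: DiaconisSaloffcoste1996, Theorem 3.7] [cite: ShenZhuZhu2022, Corollary 4.4] -/
theorem coldStart_concentration_uniform (L : ℕ) [NeZero L] (β' : ℝ) (hβ : |β'| < 1 / 12)
    (f : (Edge 3 L × Fin 2 × Fin 2 × Bool → ℝ) → ℝ) (hf : ContDiff ℝ 3 f) {s : ℝ} (hs : 0 < s)
    (hΓ : ∀ V : GaugeConfig 3 L (Matrix.specialUnitaryGroup (Fin 2) ℂ),
      (∑ i : Edge 3 L × Fin 2 × Fin 2 × Bool, ∑ j : Edge 3 L × Fin 2 × Fin 2 × Bool,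
        fderiv ℝ f ((fun (V : GaugeConfig 3 L (Matrix.specialUnitaryGroup (Fin 2) ℂ)) (q : Edge 3 L × Fin 2 × Fin 2 × Bool) =>
          (fun z : ℂ => if q.2.2.2 then z.im else z.re)
            ((fundamentalRep (Fin 2) (V q.1) : Matrix (Fin 2) (Fin 2) ℂ) q.2.1 q.2.2.1)) V) (Pi.single i 1) *
        fderiv ℝ f ((fun (V : GaugeConfig 3 L (Matrix.specialUnitaryGroup (Fin 2) ℂ)) (q : Edge 3 L × Fin 2 × Fin 2 × Bool) =>
          (fun z : ℂ => if q.2.2.2 then z.im else z.re)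
            ((fundamentalRep (Fin 2) (V q.1) : Matrix (Fin 2) (Fin 2) ℂ) q.2.1 q.2.2.1)) V) (Pi.single j 1) *
        ∑ n : Edge 3 L × NoiseIdx 2,
          (if n.1 = i.1 then (fun z : ℂ => if i.2.2.2 then z.im else z.re)
            ((latticeLangevinDynamics (fundamentalLatticeRep 2) β').noise
              (matrixConfig (fundamentalRep (Fin 2)) V) i.1 n.2 i.2.1 i.2.2.1) else 0) *
          (if n.1 = j.1 then (fun z : ℂ => if j.2.2.2 then z.im else z.re)
            ((latticeLangevinDynamics (fundamentalLatticeRep 2) β').noise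
              (matrixConfig (fundamentalRep (Fin 2)) V) j.1 n.2 j.2.1 j.2.2.1) else 0)) ≤ s)
    (z : GaugeConfig 3 L (Matrix.specialUnitaryGroup (Fin 2) ℂ))
    {Ω : Type} [MeasurableSpace Ω] {P : Measure Ω} [IsProbabilityMeasure P]
    {W : ℝ≥0 → Ω → (Edge 3 L × NoiseIdx 2 → ℝ)} (hW : IsFlatBrownian W P)
    {U : ℝ≥0 → Ω → GaugeConfig 3 L (Matrix.specialUnitaryGroup (Fin 2) ℂ)} (hU0 : ∀ ω, U 0 ω = z)
    (hU : (latticeLangevinDynamics (fundamentalLatticeRep 2) β').IsSolution (fundamentalRep (Fin 2)) hW.natFiltration P W U)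
    (t₀ u : ℝ≥0)
    (ht₀ : Real.log (96 * |β'| * (Fintype.card (Edge 3 L) : ℝ) + 10 * |β'| * (Fintype.card (Plaquette 3 L) : ℝ) + Real.log 2 +
      (Fintype.card (Edge 3 L) : ℝ) * Real.log (3 / 2)) ≤ 2 * (1 - 12 * |β'|) * t₀)
    {r : ℝ} (hr : 0 ≤ r) :
    P.real {ω | (∫ V, f ((fun (V : GaugeConfig 3 L (Matrix.specialUnitaryGroup (Fin 2) ℂ)) (q : Edge 3 L × Fin 2 × Fin 2 × Bool) =>
          (fun z : ℂ => if q.2.2.2 then z.im else z.re)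
            ((fundamentalRep (Fin 2) (V q.1) : Matrix (Fin 2) (Fin 2) ℂ) q.2.1 q.2.2.1)) V)
          ∂(wilsonMeasure (d := 3) (L := L) (fundamentalRep (Fin 2)) β')) + r ≤
        f ((fun (V : GaugeConfig 3 L (Matrix.specialUnitaryGroup (Fin 2) ℂ)) (q : Edge 3 L × Fin 2 × Fin 2 × Bool) =>
          (fun z : ℂ => if q.2.2.2 then z.im else z.re)
            ((fundamentalRep (Fin 2) (V q.1) : Matrix (Fin 2) (Fin 2) ℂ) q.2.1 q.2.2.1)) (U (2 + t₀ + u) ω))} ≤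
      Real.exp 1 * Real.exp (-((1 - 12 * |β'|) * r ^ 2 / (2 * s))) := by
  classical
  haveI := secondCountableTopology_su2
  haveI := borelSpace_config L
  haveI : IsProbabilityMeasure (wilsonMeasure (d := 3) (L := L) (fundamentalRep (Fin 2)) β') :=
    isProbabilityMeasure_wilsonMeasure (d := 3) (L := L) (fundamentalRep (Fin 2)) (continuous_fundamentalRep (Fin 2)) β'
  set coords : GaugeConfig 3 L (Matrix.specialUnitaryGroup (Fin 2) ℂ) → (Edge 3 L × Fin 2 × Fin 2 × Bool → ℝ) :=
    fun V q => (fun z : ℂ => if q.2.2.2 then z.im else z.re)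
      ((fundamentalRep (Fin 2) (V q.1) : Matrix (Fin 2) (Fin 2) ℂ) q.2.1 q.2.2.1) with hcoords
  have hco : Continuous coords := continuous_coords (L := L)
  have hFc : Continuous fun V => f (coords V) := hf.continuous.comp hco
  set m : ℝ := ∫ V, f (coords V) ∂(wilsonMeasure (d := 3) (L := L) (fundamentalRep (Fin 2)) β') with hm
  set A : Set (GaugeConfig 3 L (Matrix.specialUnitaryGroup (Fin 2) ℂ)) := {V | m + r ≤ f (coords V)} with hAdef
  have hA : MeasurableSet A := measurableSet_le measurable_const hFc.measurable
  -- the event is the preimage of `A`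
  have hmU : Measurable (U (2 + t₀ + u)) := (hU.adapted _).mono (hW.natFiltration.le _) le_rfl
  have hev : P.real {ω | m + r ≤ f (coords (U (2 + t₀ + u) ω))} = (P.map (U (2 + t₀ + u))).real A := by
    rw [measureReal_def, measureReal_def, Measure.map_apply hmU hA]; rfl
  rw [hev]
  have h1 := measureReal_map_le_exp_mul_sqrt_uniform L β' hβ z hW hU0 hU hA t₀ u ht₀
  have h2 : (wilsonMeasure (d := 3) (L := L) (fundamentalRep (Fin 2)) β').real A ≤ Real.exp (-((1 - 12 * |β'|) * r ^ 2 / s)) :=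
    wilson_concentration_uniform L β' hβ f hf hs hΓ r hr
  have h3 : ((wilsonMeasure (d := 3) (L := L) (fundamentalRep (Fin 2)) β').real A) ^ (1 / (2 : ℝ)) ≤
      Real.exp (-((1 - 12 * |β'|) * r ^ 2 / (2 * s))) := by
    have h := Real.rpow_le_rpow measureReal_nonneg h2 (by norm_num : (0 : ℝ) ≤ 1 / 2)
    have e : Real.exp (-((1 - 12 * |β'|) * r ^ 2 / s)) ^ (1 / (2 : ℝ)) = Real.exp (-((1 - 12 * |β'|) * r ^ 2 / (2 * s))) := by
      rw [← Real.exp_mul]; congr 1; field_simp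
    rw [e] at h; exact h
  exact h1.trans (mul_le_mul_of_nonneg_left h3 (Real.exp_pos 1).le)

end Summit.QuantumFields.YangMills.Theorems.ColdStartUniversality

end
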